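import Mathlib
import Literature.Computability.AlgebraicComplexity.EquivariantDC
import Literature.Computability.AlgebraicComplexity.StandardFamiliesProofs
import Literature.Computability.AlgebraicComplexity.DeterminantalComplexityProofs
import Summits.ValiantsHypothesis.ValiantsHypothesis.Theorems.SymPencilEquivariantSdcNotQPConjugationNormalForm
import HarnessLib

/-!
# ValiantsHypothesis / SymPencil — crux `EquivariantSdcNotQP` (stmt-ValiantsHypothesis-17792),
# line `Cruxes/SdcThesis/Lines/birth_EquivariantSdcNotQP.lean`: the load-bearing stub `stub_permify`
# REDUCED to its representation theory (step (iv) proved; kernel-checked decomposition)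

The line PERMIFY-TO-DAWAR–WILSENACH closes the crux from two stubs; `stub_toSymmetricCircuit` is
landed (`…StubToSymmetricCircuit.lean`), so the line rests on `stub_permify` ("linear lifts ⇒
permutation lifts at quasi-polynomial cost").  Its card splits it into four steps:
(i) normalise at the `Γ_n`-fixed point `J` to CONJUGATION equivariance — landed
(`conjugationNormalForm`, `…ConjugationNormalForm.lean`); (ii) pass to a FINITE lift group;
(iii) embed its representation into a PERMUTATION representation of quasi-polynomial dimension;
(iv) extend the pencil by the identity on a complement.  This file (helper of the item,
`--supports stmt-ValiantsHypothesis-17792 --as helper`; no definitions, no named facts):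

* `conjugationNormalForm_rename` — step (i) in the currency of the stub: for every pair of
  permutations a conjugation `B(x_{π i, ρ j}) = g⁻¹ B(x) g` (the generator `P_{π⁻¹ × ρ⁻¹} ∈ Γ_n`
  acts by `rename (π × ρ)`, `linSubst_permMatrix`).
* `exists_permConj_extension` — **step (iv), proved** over any commutative ring and any family of
  substitutions: if `B` (size `m₀`, affine entries) is carried by lifts `g` and `k^{m₀}` is an
  equivariant retract of a permutation action on `k^{m'}` (`p ι = 1`, `P_τ ι = ι g`, `p P_τ = g p`),
  then `A' := 1 + ι (B - 1) p` has affine entries, `det A' = det B` (Weinstein–Aronszajn,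
  `Matrix.det_one_add_mul_comm`) and `A'(φ ·) = P_σ A' P_σᵀ`.  No rescaling is needed.
* `permify_of_finiteLift_of_permEmbedding` — **the decomposition, kernel-checked**: the registered
  signature of `stub_permify` (with the line file's `abbrev permPairSubst n` spelled out, as in the
  route statement `Theses/SymPencil.lean :: EquivariantSdcNotQP`) FOLLOWS from two inline hypotheses,
  (ii′) FINITE CONJUGATION LIFT — the normal form of (i) can be replaced by a pencil `B₀` of size
  `m₀ ≤ m`, `det B₀ = per_n`, carried by a subgroup `F ≤ (𝔖_n × 𝔖_n) × GL_{m₀}(ℂ)` over every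
  `(π, ρ)` with unimodular matrices and SCALAR fibre over `(1, 1)` (hence `F` finite, a central
  extension of `𝔖_n × 𝔖_n` by `m₀`-th roots of unity); and (iii′) PERMUTATION EMBEDDING — for every
  such `F`, `ℂ^{m₀}` is an equivariant retract of a permutation `F`-set of size
  `≤ 2^{(log₂ m₀ + log₂ n + d)^d}`.  The budget composes to `2^{(log₂ m + d')^{d'}}`, `d' = 2d + 2`,
  because `m₀ ≤ m` and `n = deg per_n ≤ m` (`totalDegree_le_of_hasDetRepr_holds`).

What remains of `stub_permify` is exactly (ii′) ∧ (iii′).  (ii′) is elementary algebra (intended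
route: a `per_n`-carrying composition factor of `ℂ^m` under the algebra generated by the
coefficients of `B`; Jordan–Hölder transports the lifts; Schur's lemma makes the commutant scalar;
`det`-one normalisation makes the lift group finite — irreducibility of `per_n` is the only
external input).  (iii′) is the honest representation-theoretic core named by the line card
(Young's rule and degree bounds for `𝔖_n × 𝔖_n` and its double covers — NOT in Mathlib): its
truth is expected, not claimed.  The symmetry hypothesis `A.IsSymm` of the stub is not used.

## Open pieces (verbatim Lean text of the two hypotheses, to be landed as separate theorems)

(ii′) `FiniteConjugationLift` — size L (elementary algebra; see the intended route above):
```
∀ (n m : ℕ) (B : Matrix (Fin m) (Fin m) (MvPolynomial (Fin n × Fin n) ℂ)),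
  IsAffineDetRepr (perPoly (Fin n) ℂ) B →
  (∃ c : ℂ, c ≠ 0 ∧
    B.map (MvPolynomial.eval fun _ => (1 : ℂ)) = c • (1 : Matrix (Fin m) (Fin m) ℂ)) →
  (∀ π ρ : Equiv.Perm (Fin n), ∃ g : GL (Fin m) ℂ,
    B.map (MvPolynomial.rename fun ij : Fin n × Fin n => (π ij.1, ρ ij.2)) =
      ((g⁻¹ : GL (Fin m) ℂ) : Matrix (Fin m) (Fin m) ℂ).map MvPolynomial.C * B *
        (g : Matrix (Fin m) (Fin m) ℂ).map MvPolynomial.C) →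
  ∃ m₀ ≤ m, ∃ (B₀ : Matrix (Fin m₀) (Fin m₀) (MvPolynomial (Fin n × Fin n) ℂ))
    (F : Subgroup ((Equiv.Perm (Fin n) × Equiv.Perm (Fin n)) × GL (Fin m₀) ℂ)),
    IsAffineDetRepr (perPoly (Fin n) ℂ) B₀ ∧
    (∀ π ρ : Equiv.Perm (Fin n), ∃ g : GL (Fin m₀) ℂ, ((π, ρ), g) ∈ F) ∧
    (∀ g : GL (Fin m₀) ℂ, ((1 : Equiv.Perm (Fin n) × Equiv.Perm (Fin n)), g) ∈ F →
      ∃ c : ℂ, (g : Matrix (Fin m₀) (Fin m₀) ℂ) = c • (1 : Matrix (Fin m₀) (Fin m₀) ℂ)) ∧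
    (∀ x ∈ F, Matrix.det (x.2 : Matrix (Fin m₀) (Fin m₀) ℂ) = 1) ∧
    (∀ x ∈ F, B₀.map (MvPolynomial.rename fun ij : Fin n × Fin n => (x.1.1 ij.1, x.1.2 ij.2)) =
      ((x.2⁻¹ : GL (Fin m₀) ℂ) : Matrix (Fin m₀) (Fin m₀) ℂ).map MvPolynomial.C * B₀ *
        (x.2 : Matrix (Fin m₀) (Fin m₀) ℂ).map MvPolynomial.C)
```
(iii′) `PermEmbeddingQP` — size XL (Young's rule `S^λ ⊆ M^λ`, Specht-module degree lower bounds,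
and the same for the double covers / the `sgn ∪ sgn` cocycle of `𝔖_n × 𝔖_n`; the generic
averaging-retraction embedding into `ℂ^{F × [m₀]}` only pays for constituents of dimension
`2^{Ω(n)}`; none of this is in Mathlib):
```
∃ d : ℕ, ∀ (n m₀ : ℕ)
  (F : Subgroup ((Equiv.Perm (Fin n) × Equiv.Perm (Fin n)) × GL (Fin m₀) ℂ)),
  (∀ π ρ : Equiv.Perm (Fin n), ∃ g : GL (Fin m₀) ℂ, ((π, ρ), g) ∈ F) →
  (∀ g : GL (Fin m₀) ℂ, ((1 : Equiv.Perm (Fin n) × Equiv.Perm (Fin n)), g) ∈ F →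
    ∃ c : ℂ, (g : Matrix (Fin m₀) (Fin m₀) ℂ) = c • (1 : Matrix (Fin m₀) (Fin m₀) ℂ)) →
  (∀ x ∈ F, Matrix.det (x.2 : Matrix (Fin m₀) (Fin m₀) ℂ) = 1) →
  ∃ m' ≤ 2 ^ ((Nat.log 2 m₀ + Nat.log 2 n + d) ^ d),
    ∃ (ι : Matrix (Fin m') (Fin m₀) ℂ) (p : Matrix (Fin m₀) (Fin m') ℂ)
      (τ : (Equiv.Perm (Fin n) × Equiv.Perm (Fin n)) × GL (Fin m₀) ℂ → Equiv.Perm (Fin m')),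
      p * ι = 1 ∧ ∀ x ∈ F,
        (τ x).permMatrix ℂ * ι = ι * (x.2 : Matrix (Fin m₀) (Fin m₀) ℂ) ∧
        p * (τ x).permMatrix ℂ = (x.2 : Matrix (Fin m₀) (Fin m₀) ℂ) * p
```
Conventions: `F` acts on `ℂ^{m₀}` through its second projection (a homomorphism); membership
`((π, ρ), g) ∈ F` records `B₀(x_{π i, ρ j}) = g⁻¹ B₀(x) g` — this orientation makes the lift set a
subgroup of the PRODUCT group (`rename (ππ' × ρρ') = rename (π × ρ) ∘ rename (π' × ρ')`); `τ` is
a plain function (only its values on `F` matter; Mathlib's `permMatrix` is an anti-homomorphism).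

Honest framing: a decomposition with one of four steps newly proved; `stub_permify`, the crux
`SymPencil.EquivariantSdcNotQP` and `VP ≠ VNP` remain OPEN and nothing here is progress on them.
-/

noncomputable section

set_option linter.dupNamespace false

namespace Summit.ValiantsHypothesis.ValiantsHypothesis.Theorems.SymPencilEquivariantSdcNotQP

open Literature.Computability.AlgebraicComplexity MvPolynomial Matrix

/-! ### Degree bookkeeping: constant matrices do not raise the degree -/

/-- Left multiplication by a constant matrix keeps an entrywise degree bound. [folklore] -/
theorem totalDegree_map_C_mul_apply_le {R : Type*} [CommSemiring R] {σ : Type*}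
    {ι₁ ι₂ ι₃ : Type*} [Fintype ι₂] (M : Matrix ι₁ ι₂ R) (N : Matrix ι₂ ι₃ (MvPolynomial σ R))
    {D : ℕ} (hN : ∀ c d, (N c d).totalDegree ≤ D) (a : ι₁) (b : ι₃) :
    ((M.map (MvPolynomial.C : R →+* MvPolynomial σ R) * N) a b).totalDegree ≤ D := by
  rw [Matrix.mul_apply]
  refine (MvPolynomial.totalDegree_finsetSum _ _).trans (Finset.sup_le fun x _ => ?_)
  refine (MvPolynomial.totalDegree_mul _ _).trans ?_
  rw [Matrix.map_apply, MvPolynomial.totalDegree_C, zero_add]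
  exact hN x b

/-- Right multiplication by a constant matrix keeps an entrywise degree bound. [folklore] -/
theorem totalDegree_mul_map_C_apply_le {R : Type*} [CommSemiring R] {σ : Type*}
    {ι₁ ι₂ ι₃ : Type*} [Fintype ι₂] (N : Matrix ι₁ ι₂ (MvPolynomial σ R)) (M : Matrix ι₂ ι₃ R)
    {D : ℕ} (hN : ∀ c d, (N c d).totalDegree ≤ D) (a : ι₁) (b : ι₃) :
    ((N * M.map (MvPolynomial.C : R →+* MvPolynomial σ R)) a b).totalDegree ≤ D := by
  rw [Matrix.mul_apply]
  refine (MvPolynomial.totalDegree_finsetSum _ _).trans (Finset.sup_le fun x _ => ?_)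
  refine (MvPolynomial.totalDegree_mul _ _).trans ?_
  rw [Matrix.map_apply, MvPolynomial.totalDegree_C, add_zero]
  exact hN a x

/-! ### Step (iv) of `stub_permify`: extension by the identity along an equivariant retract -/

/-- **Permutation-conjugation extension** (step (iv) of the line's `stub_permify`, proved).
Let `B` be an `m₀ × m₀` matrix of affine forms and let `ι : k^{m₀} → k^{m'}`, `p : k^{m'} → k^{m₀}`
be constant matrices with `p ι = 1` (an embedding with a retraction).  Suppose that for every
substitution `φ i` of a family (`k`-algebra endomorphisms of the polynomial ring) there are
`g ∈ GL_{m₀}(k)` and `τ ∈ 𝔖_{m'}` with `B(φ i ·) = g⁻¹ B g`, `P_τ ι = ι g` and `p P_τ = g p`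
(the permutation action of `τ` on `k^{m'}` extends the linear action of `g` on the retract).  Then
`A' := 1 + ι (B - 1) p` is an `m' × m'` matrix of affine forms with `det A' = det B`
(Weinstein–Aronszajn: `det (1 + ι X p) = det (1 + X p ι) = det (1 + X)`) on which every `φ i`
acts by CONJUGATION WITH A PERMUTATION MATRIX: `A'(φ i ·) = P_σ A' P_σᵀ` (`σ = τ⁻¹`).
[folklore] -/
theorem exists_permConj_extension {k : Type*} [CommRing k] {σ : Type*} {I : Type*} {m₀ m' : ℕ}
    (φ : I → (MvPolynomial σ k →ₐ[k] MvPolynomial σ k))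
    (B : Matrix (Fin m₀) (Fin m₀) (MvPolynomial σ k)) (hB : ∀ a b, (B a b).totalDegree ≤ 1)
    (ι : Matrix (Fin m') (Fin m₀) k) (p : Matrix (Fin m₀) (Fin m') k) (hpι : p * ι = 1)
    (hlift : ∀ i, ∃ (g : GL (Fin m₀) k) (τ : Equiv.Perm (Fin m')),
      B.map (φ i) = ((g⁻¹ : GL (Fin m₀) k) : Matrix (Fin m₀) (Fin m₀) k).map
            (MvPolynomial.C : k →+* MvPolynomial σ k) * B *
          (g : Matrix (Fin m₀) (Fin m₀) k).map (MvPolynomial.C : k →+* MvPolynomial σ k) ∧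
        τ.permMatrix k * ι = ι * (g : Matrix (Fin m₀) (Fin m₀) k) ∧
        p * τ.permMatrix k = (g : Matrix (Fin m₀) (Fin m₀) k) * p) :
    ∃ A' : Matrix (Fin m') (Fin m') (MvPolynomial σ k),
      (∀ a b, (A' a b).totalDegree ≤ 1) ∧ A'.det = B.det ∧
      ∀ i, ∃ σ' : Equiv.Perm (Fin m'),
        A'.map (φ i) = (σ'.permMatrix k).map (MvPolynomial.C : k →+* MvPolynomial σ k) * A' *
          ((σ'.permMatrix k)ᵀ).map (MvPolynomial.C : k →+* MvPolynomial σ k) := by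
  classical
  -- notation: constant matrices pushed into the polynomial ring
  set Cm : k → MvPolynomial σ k := ⇑(MvPolynomial.C : k →+* MvPolynomial σ k) with hCm
  have hC1 : ∀ {l : ℕ}, ((1 : Matrix (Fin l) (Fin l) k).map Cm) = 1 :=
    fun {l} => Matrix.map_one _ (map_zero _) (map_one _)
  refine ⟨1 + ι.map Cm * (B - 1) * p.map Cm, ?_, ?_, ?_⟩
  · -- affine entries
    intro a b
    refine (MvPolynomial.totalDegree_add _ _).trans (max_le ?_ ?_)
    · rw [Matrix.one_apply]
      split_ifs
      · exact MvPolynomial.totalDegree_one.le.trans zero_le_one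
      · exact MvPolynomial.totalDegree_zero.le.trans zero_le_one
    · refine totalDegree_mul_map_C_apply_le _ _ (fun c d => ?_) a b
      refine totalDegree_map_C_mul_apply_le _ _ (fun c' d' => ?_) c d
      refine (MvPolynomial.totalDegree_sub _ _).trans (max_le (hB c' d') ?_)
      rw [Matrix.one_apply]
      split_ifs
      · exact MvPolynomial.totalDegree_one.le.trans zero_le_one
      · exact MvPolynomial.totalDegree_zero.le.trans zero_le_one
  · -- determinant: Weinstein–Aronszajn
    rw [Matrix.mul_assoc, Matrix.det_one_add_mul_comm, Matrix.mul_assoc, ← Matrix.map_mul, hpι,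
      hC1, Matrix.mul_one, add_sub_cancel]
  · -- conjugation by permutation matrices
    intro i
    obtain ⟨g, τ, hBg, hι, hp⟩ := hlift i
    refine ⟨τ⁻¹, ?_⟩
    set G : Matrix (Fin m₀) (Fin m₀) k := (g : Matrix (Fin m₀) (Fin m₀) k) with hG
    set G' : Matrix (Fin m₀) (Fin m₀) k := ((g⁻¹ : GL (Fin m₀) k) : Matrix (Fin m₀) (Fin m₀) k) with hG'
    set P : Matrix (Fin m') (Fin m') k := τ.permMatrix k with hP
    set P' : Matrix (Fin m') (Fin m') k := (τ⁻¹).permMatrix k with hP'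
    have hPinv : P' * P = 1 := by
      rw [hP, hP', ← Matrix.permMatrix_mul, mul_inv_cancel, Matrix.permMatrix_one]
    have hginv : G' * G = 1 := Units.inv_mul g
    have hginv' : G * G' = 1 := Units.mul_inv g
    -- `P_{τ⁻¹} ι = ι g⁻¹`
    have hι' : P' * ι = ι * G' := by
      calc P' * ι = P' * ι * (G * G') := by rw [hginv', Matrix.mul_one]
        _ = P' * (P * ι) * G' := by rw [hι, Matrix.mul_assoc, Matrix.mul_assoc, Matrix.mul_assoc]
        _ = ι * G' := by rw [← Matrix.mul_assoc, hPinv, Matrix.one_mul]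
    -- the transpose of `P_{τ⁻¹}` is `P_τ`
    have hT : ((τ⁻¹).permMatrix k)ᵀ = P := by
      rw [Matrix.transpose_permMatrix, inv_inv]
    rw [hT]
    change (1 + ι.map Cm * (B - 1) * p.map Cm).map (φ i) =
      P'.map Cm * (1 + ι.map Cm * (B - 1) * p.map Cm) * P.map Cm
    -- both sides equal `1 + (ι g⁻¹) (B - 1) (g p)` pushed through `C`
    have hφC : ∀ {l l' : ℕ} (M : Matrix (Fin l) (Fin l') k), (M.map Cm).map (φ i) = M.map Cm := by
      intro l l' M
      ext a b
      simp only [Matrix.map_apply, hCm, MvPolynomial.algHom_C, MvPolynomial.algebraMap_eq]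
    have lhs : (1 + ι.map Cm * (B - 1) * p.map Cm).map (φ i) =
        1 + (ι * G').map Cm * (B - 1) * (G * p).map Cm := by
      rw [Matrix.map_add _ (map_add (φ i)), Matrix.map_one _ (map_zero _) (map_one _),
        Matrix.map_mul, Matrix.map_mul, hφC, hφC, Matrix.map_sub _ (map_sub (φ i)),
        Matrix.map_one _ (map_zero _) (map_one _), hBg]
      -- `g⁻¹ B g - 1 = g⁻¹ (B - 1) g`
      have : G'.map Cm * B * G.map Cm - 1 = G'.map Cm * (B - 1) * G.map Cm := by
        rw [Matrix.mul_sub, Matrix.sub_mul, Matrix.mul_one, ← Matrix.map_mul, hginv, hC1]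
      rw [this, Matrix.map_mul, Matrix.map_mul]
      simp only [Matrix.mul_assoc, hCm]
    have rhs : P'.map Cm * (1 + ι.map Cm * (B - 1) * p.map Cm) * P.map Cm =
        1 + (ι * G').map Cm * (B - 1) * (G * p).map Cm := by
      rw [Matrix.mul_add, Matrix.add_mul, Matrix.mul_one, ← Matrix.map_mul, hPinv, hC1, ← hι', ← hp,
        Matrix.map_mul, Matrix.map_mul]
      simp only [Matrix.mul_assoc, hCm]
    rw [lhs, rhs]

/-! ### Step (i) in `rename` form -/

/-- **Conjugation normal form, generator form** (step (i) of `stub_permify`, from the landed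
`conjugationNormalForm`): a `Γ_n`-equivariant affine determinantal representation of `per_n` can be
renormalised at the same size to `B` with `det B = per_n`, `B(J) = c · 1` (`c ≠ 0`) and, for every
pair of permutations, a conjugation `B(x_{π i, ρ j}) = g⁻¹ B(x) g`, `g ∈ GL_m(ℂ)` — the generator
`P_{π⁻¹ × ρ⁻¹} ∈ Γ_n` acts on polynomials by `rename (π × ρ)` (`linSubst_permMatrix`). [folklore] -/
theorem conjugationNormalForm_rename (n m : ℕ)
    (A : Matrix (Fin m) (Fin m) (MvPolynomial (Fin n × Fin n) ℂ))
    (hA : IsEquivariantDetRepr (Subgroup.closure {γ : GL (Fin n × Fin n) ℂ |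
        ∃ π ρ : Equiv.Perm (Fin n), (γ : Matrix (Fin n × Fin n) (Fin n × Fin n) ℂ) =
          Equiv.Perm.permMatrix ℂ (Equiv.prodCongr π ρ)}) (perPoly (Fin n) ℂ) A) :
    ∃ B : Matrix (Fin m) (Fin m) (MvPolynomial (Fin n × Fin n) ℂ),
      IsAffineDetRepr (perPoly (Fin n) ℂ) B ∧
      (∃ c : ℂ, c ≠ 0 ∧
        B.map (MvPolynomial.eval fun _ => (1 : ℂ)) = c • (1 : Matrix (Fin m) (Fin m) ℂ)) ∧
      ∀ π ρ : Equiv.Perm (Fin n), ∃ g : GL (Fin m) ℂ,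
        B.map (MvPolynomial.rename fun ij : Fin n × Fin n => (π ij.1, ρ ij.2)) =
          ((g⁻¹ : GL (Fin m) ℂ) : Matrix (Fin m) (Fin m) ℂ).map MvPolynomial.C * B *
            (g : Matrix (Fin m) (Fin m) ℂ).map MvPolynomial.C := by
  obtain ⟨B, hB, hBJ, hlifts⟩ := conjugationNormalForm n m A hA
  refine ⟨B, hB, hBJ, fun π ρ => ?_⟩
  set e : Equiv.Perm (Fin n × Fin n) := Equiv.prodCongr π⁻¹ ρ⁻¹ with he
  -- the generator `P_e ∈ Γ_n` as an element of `GL(n², ℂ)`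
  let γ : GL (Fin n × Fin n) ℂ :=
    ⟨e.permMatrix ℂ, e⁻¹.permMatrix ℂ,
      by rw [← Matrix.permMatrix_mul, inv_mul_cancel, Matrix.permMatrix_one],
      by rw [← Matrix.permMatrix_mul, mul_inv_cancel, Matrix.permMatrix_one]⟩
  have hγ : γ ∈ Subgroup.closure {γ : GL (Fin n × Fin n) ℂ |
      ∃ π ρ : Equiv.Perm (Fin n), (γ : Matrix (Fin n × Fin n) (Fin n × Fin n) ℂ) =
        Equiv.Perm.permMatrix ℂ (Equiv.prodCongr π ρ)} :=
    Subgroup.subset_closure ⟨π⁻¹, ρ⁻¹, rfl⟩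
  obtain ⟨g, hg⟩ := hlifts γ hγ
  refine ⟨g⁻¹, ?_⟩
  rw [inv_inv]
  have hsub : Matrix.linSubstEntries γ B =
      B.map (MvPolynomial.rename fun ij : Fin n × Fin n => (π ij.1, ρ ij.2)) := by
    change B.map (linSubst (Fin n × Fin n) ℂ (e.permMatrix ℂ)) = _
    rw [linSubst_permMatrix]
    have hfun : (⇑e.symm : Fin n × Fin n → Fin n × Fin n) = fun ij => (π ij.1, ρ ij.2) := by
      funext ij
      simp only [he, Equiv.prodCongr_symm, Equiv.prodCongr_apply, Equiv.Perm.inv_def,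
        Equiv.symm_symm]
      rfl
    rw [hfun]
  rw [← hsub, hg]

/-! ### Quasi-polynomial bookkeeping -/

/-- `(2L + d)^d ≤ (L + (2d+2))^{2d+2}`: a qp bound in `log₂ m₀ + log₂ n ≤ 2 log₂ m` is a qp bound
in `log₂ m`. [folklore] -/
theorem two_mul_add_pow_le (L d : ℕ) : (2 * L + d) ^ d ≤ (L + (2 * d + 2)) ^ (2 * d + 2) := by
  have hb : 2 * L + d ≤ (L + d + 2) ^ 2 := by nlinarith
  calc (2 * L + d) ^ d ≤ ((L + d + 2) ^ 2) ^ d := Nat.pow_le_pow_left hb d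
    _ = (L + d + 2) ^ (2 * d) := by rw [← pow_mul]
    _ ≤ (L + (2 * d + 2)) ^ (2 * d) := Nat.pow_le_pow_left (by omega) _
    _ ≤ (L + (2 * d + 2)) ^ (2 * d + 2) := Nat.pow_le_pow_right (by omega) (by omega)

/-! ### The reduction: `stub_permify` from steps (ii) and (iii) -/

/-- **`stub_permify` reduced to its representation theory** (kernel-checked decomposition of the
load-bearing stub of the line `birth_EquivariantSdcNotQP`; the conclusion is the registered
signature of `stub_permify` with `permPairSubst n` — an `abbrev` of the line file — spelled out).

* Hypothesis `h₂` = step (ii), FINITE CONJUGATION LIFT: a conjugation-equivariant affine pencil `B`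
  for `per_n` (the output of step (i), `conjugationNormalForm`, landed) can be replaced by a pencil
  `B₀` of size `m₀ ≤ m` with `det B₀ = per_n` whose substitutions `x_{ij} ↦ x_{π i, ρ j}` are undone,
  `B₀(π,ρ · x) = g⁻¹ B₀ g`, by the elements of a subgroup `F ≤ (𝔖_n × 𝔖_n) × GL_{m₀}(ℂ)` over EVERY
  `(π, ρ)`, with unimodular matrices, and SCALAR fibre over `(1,1)` — so `F` is a finite central
  extension of `𝔖_n × 𝔖_n` by `m₀`-th roots of unity.  (Intended proof, not given here: a
  `per_n`-carrying composition factor of `ℂ^m` under the algebra generated by the coefficients of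
  `B`, Jordan–Hölder, irreducibility of `per_n`, Schur's lemma, `det`-one normalisation.)
* Hypothesis `h₃` = step (iii), PERMUTATION EMBEDDING AT QUASI-POLYNOMIAL COST: for every such `F`
  the `F`-module `ℂ^{m₀}` is an equivariant retract (`p ι = 1`, `P_τ ι = ι g`, `p P_τ = g p`) of a
  permutation `F`-module of dimension `≤ 2^{(log₂ m₀ + log₂ n + d)^d}` — the honest core of the line
  (Young's rule and degree bounds for `𝔖_n × 𝔖_n` and its double covers; NOT in Mathlib).
* Steps (i) (`conjugationNormalForm`, generators `P_{π⁻¹ × ρ⁻¹} ∈ Γ_n` act by `rename (π × ρ)`,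
  `linSubst_permMatrix`) and (iv) (`exists_permConj_extension`) are proved; the budget composes
  because `m₀ ≤ m` and `n = deg per_n ≤ m` (`totalDegree_le_of_hasDetRepr_holds`), via
  `two_mul_add_pow_le`.  The symmetry hypothesis `A.IsSymm` of the stub is not used.
Honest framing: a decomposition, not a proof — `stub_permify`, the crux `EquivariantSdcNotQP` and
`VP ≠ VNP` all remain OPEN; nothing here is progress on them. [folklore] -/
theorem permify_of_finiteLift_of_permEmbedding
    (h₂ : ∀ (n m : ℕ) (B : Matrix (Fin m) (Fin m) (MvPolynomial (Fin n × Fin n) ℂ)),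
      IsAffineDetRepr (perPoly (Fin n) ℂ) B →
      (∃ c : ℂ, c ≠ 0 ∧
        B.map (MvPolynomial.eval fun _ => (1 : ℂ)) = c • (1 : Matrix (Fin m) (Fin m) ℂ)) →
      (∀ π ρ : Equiv.Perm (Fin n), ∃ g : GL (Fin m) ℂ,
        B.map (MvPolynomial.rename fun ij : Fin n × Fin n => (π ij.1, ρ ij.2)) =
          ((g⁻¹ : GL (Fin m) ℂ) : Matrix (Fin m) (Fin m) ℂ).map MvPolynomial.C * B *
            (g : Matrix (Fin m) (Fin m) ℂ).map MvPolynomial.C) →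
      ∃ m₀ ≤ m, ∃ (B₀ : Matrix (Fin m₀) (Fin m₀) (MvPolynomial (Fin n × Fin n) ℂ))
        (F : Subgroup ((Equiv.Perm (Fin n) × Equiv.Perm (Fin n)) × GL (Fin m₀) ℂ)),
        IsAffineDetRepr (perPoly (Fin n) ℂ) B₀ ∧
        (∀ π ρ : Equiv.Perm (Fin n), ∃ g : GL (Fin m₀) ℂ, ((π, ρ), g) ∈ F) ∧
        (∀ g : GL (Fin m₀) ℂ, ((1 : Equiv.Perm (Fin n) × Equiv.Perm (Fin n)), g) ∈ F →
          ∃ c : ℂ, (g : Matrix (Fin m₀) (Fin m₀) ℂ) = c • (1 : Matrix (Fin m₀) (Fin m₀) ℂ)) ∧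
        (∀ x ∈ F, Matrix.det (x.2 : Matrix (Fin m₀) (Fin m₀) ℂ) = 1) ∧
        (∀ x ∈ F, B₀.map (MvPolynomial.rename fun ij : Fin n × Fin n => (x.1.1 ij.1, x.1.2 ij.2)) =
          ((x.2⁻¹ : GL (Fin m₀) ℂ) : Matrix (Fin m₀) (Fin m₀) ℂ).map MvPolynomial.C * B₀ *
            (x.2 : Matrix (Fin m₀) (Fin m₀) ℂ).map MvPolynomial.C))
    (h₃ : ∃ d : ℕ, ∀ (n m₀ : ℕ)
      (F : Subgroup ((Equiv.Perm (Fin n) × Equiv.Perm (Fin n)) × GL (Fin m₀) ℂ)),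
      (∀ π ρ : Equiv.Perm (Fin n), ∃ g : GL (Fin m₀) ℂ, ((π, ρ), g) ∈ F) →
      (∀ g : GL (Fin m₀) ℂ, ((1 : Equiv.Perm (Fin n) × Equiv.Perm (Fin n)), g) ∈ F →
        ∃ c : ℂ, (g : Matrix (Fin m₀) (Fin m₀) ℂ) = c • (1 : Matrix (Fin m₀) (Fin m₀) ℂ)) →
      (∀ x ∈ F, Matrix.det (x.2 : Matrix (Fin m₀) (Fin m₀) ℂ) = 1) →
      ∃ m' ≤ 2 ^ ((Nat.log 2 m₀ + Nat.log 2 n + d) ^ d),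
        ∃ (ι : Matrix (Fin m') (Fin m₀) ℂ) (p : Matrix (Fin m₀) (Fin m') ℂ)
          (τ : (Equiv.Perm (Fin n) × Equiv.Perm (Fin n)) × GL (Fin m₀) ℂ → Equiv.Perm (Fin m')),
          p * ι = 1 ∧ ∀ x ∈ F,
            (τ x).permMatrix ℂ * ι = ι * (x.2 : Matrix (Fin m₀) (Fin m₀) ℂ) ∧
            p * (τ x).permMatrix ℂ = (x.2 : Matrix (Fin m₀) (Fin m₀) ℂ) * p) :
    ∃ d : ℕ, ∀ (n m : ℕ) (A : Matrix (Fin m) (Fin m) (MvPolynomial (Fin n × Fin n) ℂ)),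
      A.IsSymm → IsEquivariantDetRepr (Subgroup.closure {γ : GL (Fin n × Fin n) ℂ |
        ∃ π ρ : Equiv.Perm (Fin n), (γ : Matrix (Fin n × Fin n) (Fin n × Fin n) ℂ) =
          Equiv.Perm.permMatrix ℂ (Equiv.prodCongr π ρ)}) (perPoly (Fin n) ℂ) A →
      ∃ m' ≤ 2 ^ ((Nat.log 2 m + d) ^ d),
        ∃ A' : Matrix (Fin m') (Fin m') (MvPolynomial (Fin n × Fin n) ℂ),
          IsAffineDetRepr (perPoly (Fin n) ℂ) A' ∧
          ∀ π ρ : Equiv.Perm (Fin n), ∃ σ : Equiv.Perm (Fin m'),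
            A'.map (MvPolynomial.rename fun ij : Fin n × Fin n => (π ij.1, ρ ij.2)) =
              (σ.permMatrix ℂ).map MvPolynomial.C * A' * ((σ.permMatrix ℂ)ᵀ).map MvPolynomial.C := by
  classical
  obtain ⟨d, hd⟩ := h₃
  refine ⟨2 * d + 2, fun n m A _ hA => ?_⟩
  -- `n = deg per_n ≤ m`
  have hnm : n ≤ m := by
    have h := totalDegree_le_of_hasDetRepr_holds
      (show HasDetRepr (perPoly (Fin n) ℂ) m from ⟨A, hA.1⟩)
    rwa [totalDegree_perPoly_holds, Fintype.card_fin] at h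
  -- step (i): conjugation normal form (landed), in `rename` form
  obtain ⟨B, hB, hBJ, hgen⟩ := conjugationNormalForm_rename n m A hA
  -- step (ii): finite conjugation lift
  obtain ⟨m₀, hm₀, B₀, F, hB₀, hsurj, hscal, hdet, hliftF⟩ := h₂ n m B hB hBJ hgen
  -- step (iii): permutation embedding
  obtain ⟨m', hm', ι, p, τ, hpι, hrel⟩ := hd n m₀ F hsurj hscal hdet
  -- step (iv): extension by the identity
  obtain ⟨A', hA'deg, hA'det, hA'perm⟩ := exists_permConj_extension
    (fun πρ : Equiv.Perm (Fin n) × Equiv.Perm (Fin n) =>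
      MvPolynomial.rename fun ij : Fin n × Fin n => (πρ.1 ij.1, πρ.2 ij.2))
    B₀ hB₀.1 ι p hpι (fun πρ => by
      obtain ⟨π, ρ⟩ := πρ
      obtain ⟨g, hg⟩ := hsurj π ρ
      exact ⟨g, τ ((π, ρ), g), hliftF ((π, ρ), g) hg, (hrel ((π, ρ), g) hg).1,
        (hrel ((π, ρ), g) hg).2⟩)
  refine ⟨m', ?_, A', ⟨hA'deg, hA'det.trans hB₀.2⟩, fun π ρ => hA'perm (π, ρ)⟩
  -- budget: `log₂ m₀ + log₂ n ≤ 2 log₂ m`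
  have hlog : Nat.log 2 m₀ + Nat.log 2 n + d ≤ 2 * Nat.log 2 m + d := by
    have h1 := Nat.log_mono_right (b := 2) hm₀
    have h2 := Nat.log_mono_right (b := 2) hnm
    omega
  calc m' ≤ 2 ^ ((Nat.log 2 m₀ + Nat.log 2 n + d) ^ d) := hm'
    _ ≤ 2 ^ ((2 * Nat.log 2 m + d) ^ d) :=
        Nat.pow_le_pow_right (by norm_num) (Nat.pow_le_pow_left hlog d)
    _ ≤ 2 ^ ((Nat.log 2 m + (2 * d + 2)) ^ (2 * d + 2)) :=
        Nat.pow_le_pow_right (by norm_num) (two_mul_add_pow_le _ _)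

end Summit.ValiantsHypothesis.ValiantsHypothesis.Theorems.SymPencilEquivariantSdcNotQP

end
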